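import Mathlib
import Summits.NavierStokesRegularity.NavierStokesRegularity.Theorems.ThreadingFluxAzimuthalCartanRigidVorticity
import Summits.NavierStokesRegularity.NavierStokesRegularity.Theorems.ThreadingFluxAzimuthalCartanPoiseuilleBase
import HarnessLib

/-!
# Crux `PoloidalLiouville` (stmt-NavierStokesRegularity-1222, wall W1), crux idea «azimuthal-cartan-test» (ns-idea-15 g10):
# QUADRATIC POLYNOMIAL FLOWS — unthreaded ⇒ rigid vorticity ⇒ the conclusion of C♭₀ (the lineage's note (ν), in kernel)

Support file (`--supports stmt-NavierStokesRegularity-1222`, helper; experiment cell `ns-wall-extremal`, width hand ns-wall-eng-7 g8,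
0 kit; sized S–M / NO STRIKE by ns-wall-crit-1 g7 BATCH #6).  Sequel of `ThreadingFluxAzimuthalCartanRigidVorticity.lean` ((ρ):
steady NS with vorticity `k × (y − x₀)` on a connected open `U` ⇒ `IsSkewAxis ∧ IsEquivariantOn ∧ HasConstantSwirlOn` for `k × ·`).

## What is formalised — the information note DEGREE-TWO-POLOIDAL-NOTE (ν) (ns-wall-eng-7 g7, `pub/ns-wall-extremal/ARM-B/w7g7/`,
## cross-checked exactly by ns-wall-crit-1 g6 BATCH #27) as a kernel theorem

* `hasFDerivAt_quadratic`, `curl_quadratic` — a QUADRATIC polynomial field `V y = v₀ + L y + B y y` (`L` linear, `B` bilinear, both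
  continuous linear maps of `ℝ³`) has the affine vorticity `curl V y = curlCLM L + (curlCLM ∘ B + curlCLM ∘ B♭) y`;
* `skew_of_inner_affine_eq_zero_on` (second differences at one interior point + rescaling; no analyticity used) — an affine field
  `c + M y` orthogonal to `y − x₀` on a non-empty OPEN set has `M` skew and equals `M (y − x₀)` everywhere; hence
  `exists_skew_curl_eq_of_quadratic`: a quadratic field unthreaded about `x₀` on a non-empty open set (`IsUnthreadedOn`) has RIGID
  vorticity `curl V y = M (y − x₀)`, `M` skew, on all of `ℝ³`;
* ★★ `rigidity_of_quadratic` — (ν): a quadratic polynomial steady NS flow on a connected open `U`, unthreaded about `x₀` on `U` and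
  vortical somewhere on `U`, satisfies `∃ A, IsSkewAxis A ∧ IsEquivariantOn U x₀ A V ∧ HasConstantSwirlOn U x₀ A V` (by (ρ) via
  `rigidity_of_skewVorticity` and `SilentShells.TwoAxes.exists_cross_of_skew`);
* ★ `steadyLocalRigidityUnrestricted_of_quadratic` — the exact binder shape of C♭₀ `SteadyLocalRigidityOffCentreUnrestricted`
  (twin l.278) with the extra hypothesis «`V` quadratic» (and without the then-redundant analyticity hypotheses): on EVERY ball and for
  EVERY centre the conclusion of C♭₀ holds in the class of quadratic flows — whereas C♭₀ itself is FALSE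
  (`AzimuthalCartan.not_steadyLocalRigidityOffCentreUnrestricted`, p717512; its witnesses `crossFlow γ` involve `log ρ`, `arctan`);
  ★ `steadyShellRigidity_of_quadratic` — the shape of C♯ on `shell x₀ r₁ r₂`, `0 ≤ r₁`;
* NON-VACUITY: `curl_poiseuille` — the card's Hagen–Poiseuille base `poiseuille = −ρ² e₃` (p709556) has the rigid vorticity
  `(2e₃) × y`; `poiseuille_rigidity` — (ρ) applied to it on any connected open set.

NOT formalised (honest): the note's finer structure statement (`V = λk̂ + a(I − 3k̂k̂ᵀ)y − ½|k|ρ²k̂ + ∇h₃`, `h₃` a rotation-invariant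
harmonic cubic, swirl ≡ 0) and its computer-assisted degree-3 sequel (ν⁺); degree ≥ 4 is open even on paper.  The degree-1 / affine
stratum in the Ertel-tower currency is ns-wall-eng-5 g8's `…ErtelTowerLinearFlowTower` (p712783) / `…AffineFlowRigidity` (p715306) —
cited, not restated (different hypotheses: inviscid jets, no vortical clause).

HONEST FRAME: a TOY positive class for the centre regime (polynomial flows have finitely many degrees to couple; for analytic flows the
coupling `curl(ω × V) = Δω` is infinite), information-grade, strictly below the wall; W1 movement 0; C♯, I♭, `PoloidalLiouville`
(1222), its steady stratum and NS regularity are OPEN and untouched.  No new definitions, no Props.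

## References
* A. J. Majda, A. L. Bertozzi, *Vorticity and Incompressible Flow* (CUP 2002), §1.1–§1.2, §2.1. [MajdaBertozziCUP2002]
-/

-- the summit and its single sub-problem share the name (CONVENTIONS §1)
set_option linter.dupNamespace false

noncomputable section

namespace Summit.NavierStokesRegularity.NavierStokesRegularity.Theorems.PoloidalLiouville.AzimuthalCartan.RigidVorticity

open Set Function Filter Topology Metric
open scoped RealInnerProductSpace
open Literature.Analysis.FluidPDE
open Summit.NavierStokesRegularity.NavierStokesRegularity.Theorems.PoloidalLiouville.CentreJet (E3 IsSteadyNSOn)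

/-! ## The vorticity of a quadratic polynomial field is affine -/

section Quadratic

variable {V : E3 → E3} {v₀ : E3} {L : E3 →L[ℝ] E3} {B : E3 →L[ℝ] E3 →L[ℝ] E3}

/-- The derivative of the quadratic field `y ↦ v₀ + L y + B y y`: `DV(y) h = L h + B y h + B h y`. -/
theorem hasFDerivAt_quadratic (hV : ∀ y, V y = v₀ + L y + B y y) (y : E3) :
    HasFDerivAt V (L + (B y + B.flip y)) y := by
  have hB : HasFDerivAt (fun y : E3 => B y y) (B y + B.flip y) y := by
    refine (B.hasFDerivAt_of_bilinear (hasFDerivAt_id y) (hasFDerivAt_id y)).congr_fderiv ?_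
    ext h
    simp [ContinuousLinearMap.precompR_apply, ContinuousLinearMap.precompL_apply]
  have h := ((hasFDerivAt_const v₀ y).add L.hasFDerivAt).add hB
  simp only [zero_add] at h
  exact h.congr_of_eventuallyEq (Filter.Eventually.of_forall fun z => hV z)

/-- The vorticity of the quadratic field is the affine field `curl V y = curlCLM L + (curlCLM ∘ B + curlCLM ∘ B.flip) y`. -/
theorem curl_quadratic (hV : ∀ y, V y = v₀ + L y + B y y) (y : E3) :
    curl V y = curlCLM L + (curlCLM.comp B + curlCLM.comp B.flip) y := by
  rw [curl_eq_curlCLM, (hasFDerivAt_quadratic hV y).fderiv, map_add, map_add, add_apply,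
    ContinuousLinearMap.comp_apply, ContinuousLinearMap.comp_apply]

end Quadratic

/-! ## An affine field orthogonal to `y − x₀` on an open set is a skew rotation field about `x₀` (polarisation = the card's `AzimuthalCartan.inner_skew_of_inner_self_eq_zero`, p708436) -/

/-- **Second differences.**  If the affine field `y ↦ c + M y` is orthogonal to `y − x₀` at every point of an OPEN set containing
`y₁`, then `M` is skew (`⟪M v, v⟫ = 0`) and `c + M y = M (y − x₀)` for ALL `y`: evaluate the quadratic polynomial
`⟪y − x₀, c + M y⟫` at `y₁ ± v` for small `v` and rescale. -/
theorem skew_of_inner_affine_eq_zero_on {U : Set E3} (hU : IsOpen U) {y₁ : E3} (hy₁ : y₁ ∈ U) (x₀ c : E3) (M : E3 →L[ℝ] E3)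
    (h : ∀ y ∈ U, ⟪y - x₀, c + M y⟫ = 0) : (∀ v : E3, ⟪M v, v⟫ = 0) ∧ ∀ y : E3, c + M y = M (y - x₀) := by
  obtain ⟨r, hr, hball⟩ := Metric.isOpen_iff.1 hU y₁ hy₁
  -- second differences at `y₁` for small `v`
  have hsmall : ∀ v : E3, ‖v‖ < r → ⟪M v, v⟫ = 0 ∧ ⟪y₁ - x₀, M v⟫ + ⟪v, c + M y₁⟫ = 0 := by
    intro v hv
    have hp : y₁ + v ∈ U := hball (by rw [mem_ball, dist_eq_norm, add_sub_cancel_left]; exact hv)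
    have hm : y₁ - v ∈ U := hball (by rw [mem_ball, dist_eq_norm, sub_sub_cancel_left, norm_neg]; exact hv)
    have h0 := h y₁ hy₁
    have h1 := h _ hp
    have h2 := h _ hm
    simp only [map_add, map_sub, inner_add_left, inner_add_right, inner_sub_left, inner_sub_right] at h0 h1 h2 ⊢
    rw [real_inner_comm v (M v)]
    constructor <;> linarith
  -- rescaling
  have hscale : ∀ v : E3, ∃ t : ℝ, 0 < t ∧ ‖t • v‖ < r := fun v => by
    refine ⟨r / (2 * (‖v‖ + 1)), by positivity, ?_⟩
    rw [norm_smul, Real.norm_of_nonneg (by positivity)]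
    have h1 : r / (2 * (‖v‖ + 1)) * ‖v‖ ≤ r / (2 * (‖v‖ + 1)) * (‖v‖ + 1) :=
      mul_le_mul_of_nonneg_left (by linarith) (by positivity)
    have h2 : r / (2 * (‖v‖ + 1)) * (‖v‖ + 1) = r / 2 := by field_simp
    linarith
  have hskew : ∀ v : E3, ⟪M v, v⟫ = 0 := fun v => by
    obtain ⟨t, ht, htv⟩ := hscale v
    have h1 := (hsmall (t • v) htv).1
    rw [map_smul, inner_smul_left, inner_smul_right] at h1
    simpa [ht.ne'] using h1
  have hlin : ∀ v : E3, ⟪v, c + M x₀⟫ = 0 := fun v => by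
    obtain ⟨t, ht, htv⟩ := hscale v
    have h1 := (hsmall (t • v) htv).2
    rw [map_smul, inner_smul_right, inner_smul_left] at h1
    have h2 : ⟪y₁ - x₀, M v⟫ + ⟪v, c + M y₁⟫ = 0 := by
      have : t * (⟪y₁ - x₀, M v⟫ + ⟪v, c + M y₁⟫) = 0 := by rw [mul_add]; simpa using h1
      exact (mul_eq_zero.1 this).resolve_left ht.ne'
    rw [real_inner_comm (M v) (y₁ - x₀), inner_skew_of_inner_self_eq_zero M hskew, map_sub] at h2
    simp only [inner_add_right, inner_sub_right] at h2 ⊢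
    linarith
  have hc : c + M x₀ = 0 := by
    have := hlin (c + M x₀)
    rwa [inner_self_eq_zero] at this
  refine ⟨hskew, fun y => ?_⟩
  rw [map_sub, ← sub_eq_zero, show c + M y - (M y - M x₀) = c + M x₀ by abel, hc]

/-! ## (ν) in kernel: quadratic polynomial flows -/

section Main

variable {V : E3 → E3} {p : E3 → ℝ} {U : Set E3} {x₀ v₀ : E3} {L : E3 →L[ℝ] E3} {B : E3 →L[ℝ] E3 →L[ℝ] E3}

/-- **Unthreaded quadratic flows have rigid vorticity.**  If `V y = v₀ + L y + B y y` is unthreaded about `x₀` on a non-empty open set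
`U`, then its vorticity is the infinitesimal rotation field `curl V y = M (y − x₀)` of a skew `M`, for ALL `y ∈ ℝ³`. -/
theorem exists_skew_curl_eq_of_quadratic (hU : IsOpen U) (hne : U.Nonempty) (hV : ∀ y, V y = v₀ + L y + B y y)
    (hunthr : IsUnthreadedOn U x₀ V) :
    ∃ M : E3 →L[ℝ] E3, (∀ v : E3, ⟪M v, v⟫ = 0) ∧ ∀ y : E3, curl V y = M (y - x₀) := by
  obtain ⟨y₁, hy₁⟩ := hne
  refine ⟨curlCLM.comp B + curlCLM.comp B.flip, ?_⟩
  have h := skew_of_inner_affine_eq_zero_on hU hy₁ x₀ (curlCLM L) (curlCLM.comp B + curlCLM.comp B.flip)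
    (fun y hy => by rw [← curl_quadratic hV y]; exact hunthr y hy)
  exact ⟨h.1, fun y => by rw [curl_quadratic hV y]; exact h.2 y⟩

/-- ★★ **(ν) DEGREE-TWO POLOIDAL RIGIDITY, in kernel.**  Let `V` be a quadratic polynomial field `V y = v₀ + L y + B y y` and
`(V, p)` a steady Navier–Stokes flow on a connected open set `U`, unthreaded about `x₀` on `U` and vortical somewhere on `U`.  Then the
conclusion of C♭₀ holds on `U`: `V` is infinitesimally axisymmetric about an axis through `x₀` with constant swirl.  (The lineage's
information note DEGREE-TWO-POLOIDAL-NOTE (ν), ns-wall-eng-7 g7, cross-checked by ns-wall-crit-1 g6 #27, now a theorem; its finer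
structure statement — Poiseuille + axisymmetric strain + rotation-invariant harmonic cubic — is not formalised here.) -/
theorem rigidity_of_quadratic (hU : IsOpen U) (hUc : IsPreconnected U) (hV : ∀ y, V y = v₀ + L y + B y y)
    (hNS : IsSteadyNSOn U V p) (hunthr : IsUnthreadedOn U x₀ V) (hvort : ∃ x ∈ U, curl V x ≠ 0) :
    ∃ A : E3 →L[ℝ] E3, IsSkewAxis A ∧ IsEquivariantOn U x₀ A V ∧ HasConstantSwirlOn U x₀ A V := by
  have hne : U.Nonempty := let ⟨x, hx, _⟩ := hvort; ⟨x, hx⟩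
  obtain ⟨M, hM, hcurl⟩ := exists_skew_curl_eq_of_quadratic hU hne hV hunthr
  exact ⟨M, rigidity_of_skewVorticity hU hUc hNS hM (fun y _ => hcurl y) hvort⟩

end Main

/-- ★ **(ball form, the exact shape of C♭₀ `SteadyLocalRigidityOffCentreUnrestricted` restricted to quadratic flows)**  On EVERY ball
and for EVERY centre `x₀`: a quadratic polynomial steady NS flow unthreaded about `x₀` on the ball and vortical there is infinitesimally
axisymmetric about an axis through `x₀` with constant swirl — the class in which C♭₀ (FALSE in general, p717512) holds. -/
theorem steadyLocalRigidityUnrestricted_of_quadratic :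
    ∀ (V : E3 → E3) (p : E3 → ℝ) (x₀ x₁ : E3) (ρ : ℝ), 0 < ρ →
      (∃ (v₀ : E3) (L : E3 →L[ℝ] E3) (B : E3 →L[ℝ] E3 →L[ℝ] E3), ∀ y, V y = v₀ + L y + B y y) →
      IsSteadyNSOn (ball x₁ ρ) V p → IsUnthreadedOn (ball x₁ ρ) x₀ V → (∃ x ∈ ball x₁ ρ, curl V x ≠ 0) →
      ∃ A : E3 →L[ℝ] E3, IsSkewAxis A ∧ IsEquivariantOn (ball x₁ ρ) x₀ A V ∧ HasConstantSwirlOn (ball x₁ ρ) x₀ A V :=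
  fun _ _ x₀ x₁ ρ _ ⟨_, _, _, hV⟩ hNS hunthr hvort =>
    rigidity_of_quadratic isOpen_ball (convex_ball x₁ ρ).isPreconnected hV hNS hunthr hvort (x₀ := x₀)

/-- ★ **(shell form, the shape of C♯ `SteadyShellRigidity` restricted to quadratic flows)**, `0 ≤ r₁`. -/
theorem steadyShellRigidity_of_quadratic :
    ∀ (V : E3 → E3) (p : E3 → ℝ) (x₀ : E3) (r₁ r₂ : ℝ), 0 ≤ r₁ →
      (∃ (v₀ : E3) (L : E3 →L[ℝ] E3) (B : E3 →L[ℝ] E3 →L[ℝ] E3), ∀ y, V y = v₀ + L y + B y y) →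
      IsSteadyNSOn (shell x₀ r₁ r₂) V p → IsUnthreadedOn (shell x₀ r₁ r₂) x₀ V → (∃ x ∈ shell x₀ r₁ r₂, curl V x ≠ 0) →
      ∃ A : E3 →L[ℝ] E3, IsSkewAxis A ∧ IsEquivariantOn (shell x₀ r₁ r₂) x₀ A V ∧ HasConstantSwirlOn (shell x₀ r₁ r₂) x₀ A V :=
  fun _ _ x₀ r₁ r₂ hr₁ ⟨_, _, _, hV⟩ hNS hunthr hvort =>
    rigidity_of_quadratic (isOpen_shell x₀ r₁ r₂) (isPreconnected_shell x₀ hr₁) hV hNS hunthr hvort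

/-! ## Non-vacuity: the Hagen–Poiseuille flow lies on the rigid-vorticity stratum -/

/-- The vorticity of the tree's Poiseuille base `V = −ρ² e₃` is the rigid rotation field `curl V y = (2e₃) × y`. -/
theorem curl_poiseuille (y : E3) : curl poiseuille y = cross ((2 : ℝ) • e3) (y - 0) := by
  rw [sub_zero]
  ext i
  simp only [curl]
  fin_cases i <;> simp [Poiseuille.fderiv_poiseuille_apply, cross, cross_apply, e3]

/-- **Non-vacuity.**  The rigid-vorticity theorem applies to the Poiseuille flow on every connected open set: it is infinitesimally
axisymmetric about the `e₃`-axis through `0` (axis `(2e₃) × ·`) with constant swirl there. -/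
theorem poiseuille_rigidity {U : Set E3} (hU : IsOpen U) (hUc : IsPreconnected U) :
    IsSkewAxis (crossCLM ((2 : ℝ) • e3)) ∧ IsEquivariantOn U 0 (crossCLM ((2 : ℝ) • e3)) poiseuille ∧
      HasConstantSwirlOn U 0 (crossCLM ((2 : ℝ) • e3)) poiseuille :=
  rigidity_of_rigidVorticity hU hUc (Poiseuille.isSteadyNSOn_poiseuille U)
    (by
      intro h
      have := congrArg (fun v : E3 => v 2) h
      simp [e3] at this)
    (fun y _ => curl_poiseuille y)

end Summit.NavierStokesRegularity.NavierStokesRegularity.Theorems.PoloidalLiouville.AzimuthalCartan.RigidVorticity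

end
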